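import Mathlib.MeasureTheory.Measure.Haar.Basic
import Mathlib.MeasureTheory.Function.LocallyIntegrable
import Mathlib.Analysis.Complex.Circle
import Mathlib.Analysis.SpecialFunctions.Complex.Circle
import Mathlib.Topology.ContinuousMap.Basic
import Mathlib.NumberTheory.ModularForms.JacobiTheta.TwoVariable
import Literature.MathematicalPhysics.QuantumFieldTheory.ConstructiveQFTWave0
import Literature.MathematicalPhysics.QuantumLattice.GaugeGroups
import Literature.MathematicalPhysics.QuantumLattice.LatticeGaugeDLR
import HarnessLib

-- provenance: harness21/H21/H21/Prelude/QLatticeAQFT/HeatKernelGroup.lean @ 96a2136 (interim HEAD d8f2665); M5 mechanical rewrite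
/-!
# Heat kernels on compact groups and heat-kernel lattice actions
(trunk `QLatticeAQFT`, outline A-D5 / item A13)

The two-dimensional Yang–Mills measure (Driver 1989, Sengupta 1997, Lévy 2010) and the
"heat-kernel action" of lattice gauge theory are built from the *heat kernel* `p_t` of a compact
connected Lie group `G`: the fundamental solution of `∂ₜ p = ½ Δ p` for a bi-invariant Laplacian
`Δ`, equivalently the density (w.r.t. normalised Haar measure) of the law of Brownian motion on
`G` at time `t` started at `1`.

Mathlib (at the pin) has neither Lie-group Laplacians nor Brownian motion on groups, so — as
decided in outline A-D5 — the heat kernel enters the library as a **hypothesis structure**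
`Literature.AQFT.IsGroupHeatKernel p` on a function `p : ℝ → G → ℝ`, listing the properties that the
target statements consume and that, by Hunt's theorem, *characterise* heat kernels of
bi-invariant Laplacians: `(p_t)_{t>0}` is a continuous, non-negative, normalised, central,
symmetric convolution semigroup which is an approximate identity as `t → 0⁺` and has no jumps
(`t⁻¹ P(Uᶜ) → 0`).  On a *simple* compact connected group the only residual ambiguity is the
time scale `t ↦ c t` (`isGroupHeatKernel_unique_up_to_scale`).

We then define the heat-kernel lattice weight `∏_plaquettes p_t(U_p)` and the corresponding
normalised measure on torus gauge configurations (`groupHeatKernelWeight`,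
`groupHeatKernelMeasure`; for `G = U(1)` this is the Villain action), the explicit heat kernel
of the circle group `circleHeatKernel t z = ∑ₙ e^{-n²t/2} Re zⁿ` (a Jacobi theta function,
`circleHeatKernel_eq_jacobiTheta₂`), and the Driver–Sengupta value
`ym2LoopValue χ p A = ∫ χ · p_A dHaar` of a simple loop enclosing area `A` in `YM₂`, the target
of `cqft.S27`.

## Names

The accepted G07 file `H21/Prelude/UnbddOp/HeatKernel.lean` owns `Literature.Analysis.UnboundedOperators.heatKernel` /
`Literature.Analysis.UnboundedOperators.heatSymbol` (the Gauss–Weierstrass kernel of `e^{tΔ}` on a Euclidean space, root `Literature`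
namespace).  Everything here is therefore prefixed `Group`/`group` (outline §0 (d)) and lives in
`Literature.AQFT`; note also the different time normalisation (`e^{tΔ/2}` here, the probabilists'
convention of Driver/Sengupta/Lévy, versus `e^{tΔ}` in G07).

## Mathlib anchors (grepped at the pin)

`MeasureTheory.Measure.haarMeasure` (through Wave 0's `ConstructiveQFT.haarProbability G :=
haarMeasure ⊤`, a probability measure by `GaugeGroups`), `Measure.pi`, `Measure.withDensity`,
`tsum`, `Circle`, `Circle.exp`, `jacobiTheta₂` (Mathlib's two-variable Jacobi theta function,
`∑ₙ exp (2πi n z + πi n² τ)`, of which the circle heat kernel is a special value),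
`ContinuousMap`, `Continuous.integrable_of_hasCompactSupport`.  Mathlib has no heat kernel on a
group and no `MeasurableSpace Circle` instance; the circle statements below therefore take
`[MeasurableSpace Circle] [BorelSpace Circle]` as instance *arguments* rather than declaring a
global instance on a Mathlib type (which a sibling file may also need to do).

## Sources

* G. A. Hunt, *Semi-groups of measures on Lie groups*, Trans. AMS **81** (1956) 264–293
  (Thm 5.1: generators of continuous convolution semigroups; the Gaussian/no-jump case).
* B. K. Driver, *YM₂: continuum expectations, lattice convergence, and lassos*, CMP **123**
  (1989) 575–616 (§§3–4: heat-kernel action, loop expectations `∫ χ p_{A}`).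
* A. Sengupta, *Gauge theory on compact surfaces*, Mem. AMS **600** (1997) (Ch. 2–4).
* T. Lévy, *Two-dimensional Markovian holonomy fields*, Astérisque **329** / Mem. AMS (2010)
  (§4.1: Lévy processes on compact groups, Hunt's classification; §4.2 the Brownian case).
* E. M. Stein, *Topics in Harmonic Analysis Related to the Littlewood–Paley Theory* (1970),
  Ch. II §2 (heat semigroup on a compact Lie group: positivity, semigroup, approximate identity).
* J. Villain, J. Physique **36** (1975) 581 (the periodic-Gaussian = `U(1)` heat-kernel action).

## Design choices

* All properties in `IsGroupHeatKernel` are relative to the explicit measure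
  `ConstructiveQFT.haarProbability G` (Wave 0 / `GaugeGroups` idiom, no `MeasureSpace G`).
* The fields constrain `p t` only for `t > 0`; `p t` for `t ≤ 0` is unconstrained junk.
* Convolution is written out as `∫ h, p s h * p t (h⁻¹ * g)`; Mathlib's `MeasureTheory.convolution`
  is additive-group/bilinear-map based and would obscure the statement.
-/

open MeasureTheory Filter Topology Complex
open Literature.MathematicalPhysics.QuantumFieldTheory (haarProbability GaugeConfig Plaquette Edge plaquetteHolonomy)

noncomputable section

namespace Literature.MathematicalPhysics.QuantumLattice

variable {G : Type*} [Group G] [TopologicalSpace G] [IsTopologicalGroup G] [CompactSpace G]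
  [MeasurableSpace G] [BorelSpace G]

/-! ### Heat kernels on a compact group (hypothesis structure) -/

/-- `IsGroupHeatKernel p`: the function `p : ℝ → G → ℝ`, `(t, g) ↦ p_t(g)`, is *a heat kernel*
of the compact group `G` with respect to the normalised Haar measure
`ConstructiveQFT.haarProbability G`, i.e. `(p_t dg)_{t>0}` is a symmetric central Gaussian
convolution semigroup of probability densities:

* `continuousOn`: `(t, g) ↦ p_t(g)` is jointly continuous on `(0, ∞) × G`;
* `nonneg`, `integral_eq_one`: each `p_t`, `t > 0`, is a probability density;
* `semigroup`: `p_{s+t} = p_s ⋆ p_t` (Chapman–Kolmogorov);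
* `central`: `p_t (h g h⁻¹) = p_t (g)` (bi-invariance of the Laplacian);
* `symm`: `p_t (g⁻¹) = p_t (g)` (self-adjointness / no drift);
* `tendsto_dirac`: `p_t dg → δ₁` weakly as `t → 0⁺`;
* `noJumps`: `t⁻¹ ∫_{Uᶜ} p_t → 0` for every neighbourhood `U` of `1` (continuity of paths).

By Hunt's theorem (Hunt, Trans. AMS 81 (1956) Thm 5.1; Lévy, Astérisque 329 (2010) §4.1) a
convolution semigroup with these properties on a compact connected Lie group is exactly
`p_t = e^{tΔ/2} δ₁` for a bi-invariant second-order elliptic operator `Δ` (an `Ad`-invariant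
inner product on the Lie algebra); on a simple group `Δ` is unique up to a positive scalar
(`isGroupHeatKernel_unique_up_to_scale`).  This is *not* G07's `Literature.Analysis.UnboundedOperators.heatKernel` (Gauss–Weierstrass
kernel of `e^{tΔ}` on `ℝ^d`, `H21/Prelude/UnbddOp/HeatKernel.lean`); note the factor `½`. [folklore] -/
structure IsGroupHeatKernel (p : ℝ → G → ℝ) : Prop where
  /-- Joint continuity on `(0, ∞) × G`. -/
  continuousOn : ContinuousOn (Function.uncurry p) (Set.Ioi (0 : ℝ) ×ˢ Set.univ)
  /-- `p_t ≥ 0`. -/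
  nonneg : ∀ t, 0 < t → ∀ g, 0 ≤ p t g
  /-- `∫ p_t dHaar = 1`. -/
  integral_eq_one : ∀ t, 0 < t → ∫ g, p t g ∂(haarProbability G) = 1
  /-- Chapman–Kolmogorov: `p_{s+t}(g) = ∫ p_s(h) p_t(h⁻¹ g) dh`. -/
  semigroup : ∀ s t, 0 < s → 0 < t → ∀ g,
    p (s + t) g = ∫ h, p s h * p t (h⁻¹ * g) ∂(haarProbability G)
  /-- `p_t` is a class function. -/
  central : ∀ t, 0 < t → ∀ g h, p t (h * g * h⁻¹) = p t g
  /-- `p_t` is inversion invariant. -/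
  symm : ∀ t, 0 < t → ∀ g, p t g⁻¹ = p t g
  /-- `p_t dHaar → δ₁` weakly as `t → 0⁺`. -/
  tendsto_dirac : ∀ f : C(G, ℝ),
    Tendsto (fun t => ∫ g, f g * p t g ∂(haarProbability G)) (𝓝[>] 0) (𝓝 (f 1))
  /-- No jumps: `t⁻¹ · P_t(Uᶜ) → 0` for every neighbourhood `U` of the identity. -/
  noJumps : ∀ U ∈ 𝓝 (1 : G),
    Tendsto (fun t => t⁻¹ * ∫ g in Uᶜ, p t g ∂(haarProbability G)) (𝓝[>] 0) (𝓝 0)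

namespace IsGroupHeatKernel

variable {p : ℝ → G → ℝ}

/-- Each `p_t`, `t > 0`, is continuous on `G` (restriction of joint continuity;
Stein 1970 Ch. II §2). [cite: Stein1970, Ch. II §2] -/
theorem continuous (hp : IsGroupHeatKernel p) {t : ℝ} (ht : 0 < t) : Continuous (p t) := by
  have h : ContinuousOn (Function.uncurry p ∘ fun g : G => (t, g)) Set.univ :=
    hp.continuousOn.comp (by fun_prop) fun g _ => ⟨ht, Set.mem_univ g⟩
  exact continuousOn_univ.mp h

/-- Each `p_t`, `t > 0`, is Haar-integrable (continuous on a compact group;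
Stein 1970 Ch. II §2). [cite: Stein1970, Ch. II §2] -/
theorem integrable (hp : IsGroupHeatKernel p) {t : ℝ} (ht : 0 < t) :
    Integrable (p t) (haarProbability G) :=
  (hp.continuous ht).integrable_of_hasCompactSupport (HasCompactSupport.of_compactSpace _)

/-- The heat kernel is strictly positive at the identity: `p_t(1) = ∫ p_{t/2}(h)² dh > 0`
(Stein 1970 Ch. II §2). [cite: Stein1970, Ch. II §2] -/
def apply_one_pos : Prop :=
  ∀ (hp : IsGroupHeatKernel p) {t : ℝ} (ht : 0 < t),
    0 < p t 1

/-- A time-rescaled heat kernel `(t, g) ↦ p_{ct}(g)`, `c > 0`, is again a heat kernel (it is the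
heat kernel of `c Δ`) (Lévy 2010 §4.2). [cite: Levy2010, §4.2] -/
def comp_mul : Prop :=
  ∀ (hp : IsGroupHeatKernel p) {c : ℝ} (hc : 0 < c),
    IsGroupHeatKernel (fun t g => p (c * t) g)

end IsGroupHeatKernel

/-- **Uniqueness up to time scale** (Hunt 1956 Thm 5.1 with Schur's lemma; Lévy, Astérisque 329
(2010) §4.1–4.2).  On a simple compact connected group (`QLatticeAQFT.IsSimpleCompactGroup`: connected,
non-abelian, no proper non-trivial closed connected normal subgroups — hence a simple compact Lie
group) every `Ad`-invariant inner product on the Lie algebra is a multiple of the negative Killing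
form, so any two heat kernels differ by a rescaling of time: `q_t = p_{ct}` for some `c > 0`. [cite: Hunt1956, Thm 5.1 with Schur's lemma] -/
def isGroupHeatKernel_unique_up_to_scale : Prop :=
  ∀ [T2Space G] (hG : QuantumLattice.IsSimpleCompactGroup G) {p q : ℝ → G → ℝ} (hp : IsGroupHeatKernel p) (hq : IsGroupHeatKernel q),
    ∃ c : ℝ, 0 < c ∧ ∀ t, 0 < t → ∀ g, q t g = p (c * t) g

/-! ### Heat-kernel lattice actions on the torus -/

section Lattice

variable {d L : ℕ}

/-- The heat-kernel (Boltzmann) weight of a torus gauge configuration `U : GaugeConfig d L G`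
at "time" (= bare coupling `g₀²`, = `1/β`) `t`:
`w_t(U) = ∏_{plaquettes q} p_t(U_q)`, the product over all plaquettes of the heat kernel
evaluated at the plaquette holonomy (Driver, CMP 123 (1989) §7, Def. 7.1 and (7.1), pp. 597–598,
with the heat kernel as the action function in §8, Def. 8.3 (the "Villain action"), p. 601; Menotti–Onofri, Nucl. Phys.
B190 (1981) 288).  Replacing the Wilson factor `exp(-β Re tr(1 - U_q))` by `p_{1/β}(U_q)` gives
an action in the same universality class with exact character expansion
`p_t = ∑_λ d_λ e^{-c_λ t/2} χ_λ`.  For `G = U(1) = Circle` and `p = circleHeatKernel` this is,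
by Poisson summation, `∑_{m ∈ ℤ} exp(-(θ_q + 2πm)²/(2t))` up to a constant: the **Villain
action** (Villain, J. Physique 36 (1975)).  For `p` central the weight does not depend on the
base point / orientation conventions of `plaquetteHolonomy`. [folklore] -/
def groupHeatKernelWeight [NeZero L] (p : ℝ → G → ℝ) (t : ℝ) (U : GaugeConfig d L G) : ℝ :=
  ∏ q : Plaquette d L, p t (plaquetteHolonomy U q.1 q.2.1.1 q.2.1.2)

/-- The heat-kernel weight is non-negative for a heat kernel and `t > 0`. [folklore] -/
theorem groupHeatKernelWeight_nonneg [NeZero L] {p : ℝ → G → ℝ} (hp : IsGroupHeatKernel p)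
    {t : ℝ} (ht : 0 < t) (U : GaugeConfig d L G) : 0 ≤ groupHeatKernelWeight p t U :=
  Finset.prod_nonneg fun _ _ => hp.nonneg t ht _

/-- Gauge invariance of the heat-kernel weight: plaquette holonomies transform by conjugation
and `p_t` is central (Driver 1989 §7, Def. 7.1: an action function is a class function on `G`).
[cite: Driver1989, §7 Def. 7.1 (p. 597)] -/
def groupHeatKernelWeight_gaugeTransform : Prop :=
  ∀ [NeZero L] {p : ℝ → G → ℝ} (hp : IsGroupHeatKernel p) {t : ℝ} (ht : 0 < t) (g : QuantumFieldTheory.Site d L → G) (U : GaugeConfig d L G),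
    groupHeatKernelWeight p t (QuantumFieldTheory.gaugeTransform g U) =
      groupHeatKernelWeight p t U

/-- The heat-kernel lattice gauge measure on the torus `(ℤ/L)^d` at time/coupling `t`:
`μ_t(dU) = Z⁻¹ ∏_q p_t(U_q) ∏_e dHaar(U_e)`, the normalised `withDensity` of product Haar
measure by `groupHeatKernelWeight p t` (Driver, CMP 123 (1989) §7, (7.1)–(7.4), pp. 597–598; Sengupta, Mem. AMS 600 (1997)
Ch. 4, where for `d = 2` it reproduces the continuum `YM₂` measure *exactly* on lattice loops).
Junk value: if `p t` is not measurable/non-negative, or `Z ∈ {0, ∞}`, this is not a probability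
measure; for `IsGroupHeatKernel p` and `t > 0` it is (`Z ≥ ` a positive constant since
`p_t(1) > 0` and `p_t` is continuous). [folklore] -/
def groupHeatKernelMeasure [NeZero L] (p : ℝ → G → ℝ) (t : ℝ) : Measure (GaugeConfig d L G) :=
  let w : Measure (GaugeConfig d L G) :=
    (Measure.pi fun _ : Edge d L => haarProbability G).withDensity
      fun U => ENNReal.ofReal (groupHeatKernelWeight p t U)
  (w Set.univ)⁻¹ • w

/-- For a heat kernel and `t > 0` the heat-kernel lattice measure is a probability measure
(Driver 1989 §7, (7.1): `Z_n(h)` "is the normalization constant to make `μ_n(·; h)` a probability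
measure"). [cite: Driver1989, §7 (7.1) (p. 597)] -/
def isProbabilityMeasure_groupHeatKernelMeasure : Prop :=
  ∀ [NeZero L] {p : ℝ → G → ℝ} (hp : IsGroupHeatKernel p) {t : ℝ} (ht : 0 < t),
    IsProbabilityMeasure (groupHeatKernelMeasure (d := d) (L := L) p t)

/-- Gauge invariance of the heat-kernel lattice measure (Driver 1989 §7; Thm 7.5, p. 600, for gauge-invariant
integrands): the push-forward under
`U ↦ U^g` is the same measure (product Haar is invariant, the density is gauge invariant by
`groupHeatKernelWeight_gaugeTransform`). [cite: Driver1989, §7 ((7.1); Thm 7.5 p. 600)] -/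
def groupHeatKernelMeasure_map_gaugeTransform : Prop :=
  ∀ [NeZero L] {p : ℝ → G → ℝ} (hp : IsGroupHeatKernel p) {t : ℝ} (ht : 0 < t) (g : QuantumFieldTheory.Site d L → G),
    (groupHeatKernelMeasure p t).map (QuantumFieldTheory.gaugeTransform g) =
      groupHeatKernelMeasure (d := d) (L := L) p t

end Lattice

/-! ### The heat kernel of the circle group -/

/-- The heat kernel of `U(1) = Circle` (for `½ d²/dθ²`, normalised Haar measure `dθ/2π`):
`p_t(z) = ∑_{n ∈ ℤ} e^{-n² t/2} Re (zⁿ)`, i.e. `p_t(e^{iθ}) = ∑ₙ e^{-n²t/2} cos (nθ)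
= ϑ(θ/2π, it/2π)` (a Jacobi theta value, `circleHeatKernel_eq_jacobiTheta₂`; Stein 1970 Ch. II
§2 Example; Driver 1989 §6).  For `t ≤ 0` the series diverges and `tsum` returns the junk
value `0`. [cite: Stein1970, Ch. II §2 Example] -/
def circleHeatKernel (t : ℝ) (z : Circle) : ℝ :=
  ∑' n : ℤ, Real.exp (-(n : ℝ) ^ 2 * t / 2) * ((z ^ n : Circle) : ℂ).re

/-- The circle heat kernel is a special value of Mathlib's two-variable Jacobi theta function:
`p_t(e^{iθ}) = jacobiTheta₂ (θ/2π) (it/2π) = ∑ₙ exp (i n θ - n² t/2)` for `t > 0`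
(Mumford, *Tata Lectures on Theta I*, §1; Stein 1970 Ch. II §2). [cite: Stein1970, Ch. II §2] -/
def circleHeatKernel_eq_jacobiTheta₂ : Prop :=
  ∀ {t : ℝ} (ht : 0 < t) (θ : ℝ),
    (circleHeatKernel t (Circle.exp θ) : ℂ) =
      jacobiTheta₂ (θ / (2 * Real.pi)) (I * t / (2 * Real.pi))

/-- The circle heat kernel `circleHeatKernel` is a heat kernel of `Circle` in the sense of
`IsGroupHeatKernel` (Stein 1970 Ch. II §2; positivity via the Poisson-summation / Villain form
`p_t(e^{iθ}) = √(2π/t) ∑ₘ exp(-(θ + 2πm)²/2t) > 0`).  Mathlib has no `MeasurableSpace Circle`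
instance at the pin, so the Borel structure is taken as an instance argument. [cite: Stein1970, Ch. II §2] -/
def isGroupHeatKernel_circleHeatKernel : Prop :=
  ∀ [MeasurableSpace Circle] [BorelSpace Circle],
    IsGroupHeatKernel circleHeatKernel

/-! ### The Driver–Sengupta loop value of `YM₂` -/

/-- The `YM₂` expectation of a simple loop enclosing area `A` in the plane, for the class
function `χ` (typically a normalised character `(1/N) Re tr ρ`): `W(A) = ∫_G χ(g) p_A(g) dg`,
where `p` is the heat kernel of the structure group (Driver, CMP 123 (1989) Thm 6.4; Sengupta,
Mem. AMS 600 (1997) Thm 4.2; Lévy 2010 §4.3).  For an irreducible character `χ_λ` this is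
`d_λ e^{-c_λ A/2}` — the exact area law of two-dimensional Yang–Mills.  This is the limiting
value in `cqft.S27` (`ym2_exists`).  Bochner integral; junk `0` if non-integrable. [cite: Levy2010, §4.3] -/
def ym2LoopValue (χ : G → ℝ) (p : ℝ → G → ℝ) (A : ℝ) : ℝ :=
  ∫ g, χ g * p A g ∂(haarProbability G)

namespace IsGroupHeatKernel

variable {p : ℝ → G → ℝ}

/-- For a non-negative class function `χ` the `YM₂` loop value is non-negative (`p_A ≥ 0`). [folklore] -/
theorem ym2LoopValue_nonneg (hp : IsGroupHeatKernel p) {χ : G → ℝ} (hχ : ∀ g, 0 ≤ χ g) {A : ℝ}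
    (hA : 0 < A) : 0 ≤ ym2LoopValue χ p A :=
  integral_nonneg fun g => mul_nonneg (hχ g) (hp.nonneg A hA g)

/-- `|W(A)| ≤ sup |χ|`: the loop value is bounded by the sup norm of `χ`, since `p_A` is a
probability density (Driver 1989 §6). [cite: Driver1989, §6] -/
def abs_ym2LoopValue_le : Prop :=
  ∀ (hp : IsGroupHeatKernel p) {χ : G → ℝ} {C : ℝ} (hχ : ∀ g, |χ g| ≤ C) {A : ℝ} (hA : 0 < A),
    |ym2LoopValue χ p A| ≤ C

/-- The trivial loop has value `∫ p_A = 1` for the trivial character (normalisation). [folklore] -/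
theorem ym2LoopValue_one (hp : IsGroupHeatKernel p) {A : ℝ} (hA : 0 < A) :
    ym2LoopValue (fun _ => (1 : ℝ)) p A = 1 := by
  simp only [ym2LoopValue, one_mul]
  exact hp.integral_eq_one A hA

/-- As the area shrinks the loop value tends to `χ(1)` for continuous `χ`
(`tendsto_dirac`; Driver 1989 §6). [cite: Driver1989, §6] -/
theorem tendsto_ym2LoopValue_zero (hp : IsGroupHeatKernel p) (χ : C(G, ℝ)) :
    Tendsto (fun A => ym2LoopValue χ p A) (𝓝[>] 0) (𝓝 (χ 1)) :=
  hp.tendsto_dirac χ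

end IsGroupHeatKernel

end Literature.MathematicalPhysics.QuantumLattice
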